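import Literature.Algebra.Polynomial.CasasAlvero.Char23Digits
import HarnessLib

/-!
# The four-witness criterion: centred pentanomials refuting `CA_d`

Sequel to the two- and three-witness criteria (`Trinomial.lean`, `Char23Digits.lean`): a centred pentanomial
`X^d + s X^m + t X^n + u X^l + v X^j` (`0 < j < l < n < m < d`, `v ≠ 0`) over a field `K` with `K`-rational roots `ρ, σ, τ, υ`
killing the Hasse derivatives `H_m, H_n, H_l, H_j` respectively is a Casas-Alvero polynomial (every other index `0 < i < d` is
vacuous at the root `0`) and is not a `d`-th power, so `¬ CA_d(K)`; in prime characteristic the eight conditions are integer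
congruences.  Needed where no sparser example exists: e.g. an exhaustive search finds NO centred trinomial or tetranomial of degree `7`
over `𝔽_73` with `𝔽_73`-rational witnesses, while `X^7 + 38X^4 + 32X^3 + 35X^2 + 40X` works (instance below; `73` is a bad prime for
degree `7`, in accordance with [CastryckLaterveerOunaies2012, Thm. 4]: every prime `< 127` other than `7` is). [folklore]
-/

noncomputable section

open Polynomial

namespace Literature.Algebra.Polynomial.CasasAlvero

section Pentanomial

variable {K : Type*} [Field K] {d m n l j : ℕ}

/-- the tail of the centred pentanomial has degree `< d`. [folklore] -/
theorem natDegree_pentanom_tail_lt (hjl : j < l) (hln : l < n) (hnm : n < m) (hmd : m < d) (s t u v : K) :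
    (s • (X : K[X]) ^ m + t • X ^ n + u • X ^ l + v • X ^ j).natDegree < d := by
  refine lt_of_le_of_lt (natDegree_add_le _ _) (max_lt (natDegree_tetranom_tail_lt hln hnm hmd s t u) ?_)
  exact lt_of_le_of_lt (le_trans (natDegree_smul_le _ _) (natDegree_X_pow_le j)) (by omega)

/-- reassociation of the pentanomial as `X^d + tail`. [folklore] -/
theorem pentanom_eq (s t u v : K) :
    (X ^ d + s • X ^ m + t • X ^ n + u • X ^ l + v • X ^ j : K[X]) = X ^ d + (s • X ^ m + t • X ^ n + u • X ^ l + v • X ^ j) := by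
  simp only [add_assoc]

/-- its degree is `d`. [folklore] -/
theorem natDegree_pentanom (hjl : j < l) (hln : l < n) (hnm : n < m) (hmd : m < d) (s t u v : K) :
    (X ^ d + s • X ^ m + t • X ^ n + u • X ^ l + v • X ^ j : K[X]).natDegree = d := by
  rw [pentanom_eq, natDegree_add_eq_left_of_natDegree_lt]
  · exact natDegree_X_pow d
  · rw [natDegree_X_pow]; exact natDegree_pentanom_tail_lt hjl hln hnm hmd s t u v

/-- it is monic. [folklore] -/
theorem monic_pentanom (hjl : j < l) (hln : l < n) (hnm : n < m) (hmd : m < d) (s t u v : K) :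
    (X ^ d + s • X ^ m + t • X ^ n + u • X ^ l + v • X ^ j : K[X]).Monic := by
  have h := natDegree_pentanom_tail_lt hjl hln hnm hmd s t u v
  rw [pentanom_eq]
  exact (monic_X_pow d).add_of_left
    (lt_of_le_of_lt degree_le_natDegree (by rw [degree_X_pow]; exact_mod_cast h))

/-- coefficients of the pentanomial. [folklore] -/
theorem coeff_pentanom (s t u v : K) (i : ℕ) :
    (X ^ d + s • X ^ m + t • X ^ n + u • X ^ l + v • X ^ j : K[X]).coeff i =
      (if i = d then 1 else 0) + (if i = m then s else 0) + (if i = n then t else 0) + (if i = l then u else 0) +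
        (if i = j then v else 0) := by
  simp only [coeff_add, coeff_smul, coeff_X_pow, smul_eq_mul, mul_ite, mul_one, mul_zero]

/-- evaluation of the pentanomial. [folklore] -/
theorem eval_pentanom (s t u v x : K) :
    (X ^ d + s • X ^ m + t • X ^ n + u • X ^ l + v • X ^ j : K[X]).eval x =
      x ^ d + s * x ^ m + t * x ^ n + u * x ^ l + v * x ^ j := by
  simp only [eval_add, eval_smul, eval_pow, eval_X, smul_eq_mul]

/-- evaluation of its `m`-th Hasse derivative. [folklore] -/
theorem eval_hasseDeriv_pentanom_m (hjl : j < l) (hln : l < n) (hnm : n < m) (s t u v x : K) :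
    (hasseDeriv m (X ^ d + s • X ^ m + t • X ^ n + u • X ^ l + v • X ^ j : K[X])).eval x =
      (d.choose m : K) * x ^ (d - m) + s := by
  simp only [map_add, map_smul, hasseDeriv_X_pow, eval_add, eval_smul, eval_mul, eval_C, eval_pow, eval_X, smul_eq_mul,
    Nat.choose_self, Nat.sub_self, pow_zero, mul_one, Nat.cast_one, Nat.choose_eq_zero_of_lt hnm,
    Nat.choose_eq_zero_of_lt (lt_trans hln hnm), Nat.choose_eq_zero_of_lt (lt_trans (lt_trans hjl hln) hnm), Nat.cast_zero,
    zero_mul, mul_zero, add_zero]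

/-- evaluation of its `n`-th Hasse derivative. [folklore] -/
theorem eval_hasseDeriv_pentanom_n (hjl : j < l) (hln : l < n) (s t u v x : K) :
    (hasseDeriv n (X ^ d + s • X ^ m + t • X ^ n + u • X ^ l + v • X ^ j : K[X])).eval x =
      (d.choose n : K) * x ^ (d - n) + (m.choose n : K) * s * x ^ (m - n) + t := by
  simp only [map_add, map_smul, hasseDeriv_X_pow, eval_add, eval_smul, eval_mul, eval_C, eval_pow, eval_X, smul_eq_mul,
    Nat.choose_self, Nat.sub_self, pow_zero, mul_one, Nat.cast_one, Nat.choose_eq_zero_of_lt hln,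
    Nat.choose_eq_zero_of_lt (lt_trans hjl hln), Nat.cast_zero, zero_mul, mul_zero, add_zero]
  ring

/-- evaluation of its `l`-th Hasse derivative. [folklore] -/
theorem eval_hasseDeriv_pentanom_l (hjl : j < l) (s t u v x : K) :
    (hasseDeriv l (X ^ d + s • X ^ m + t • X ^ n + u • X ^ l + v • X ^ j : K[X])).eval x =
      (d.choose l : K) * x ^ (d - l) + (m.choose l : K) * s * x ^ (m - l) + (n.choose l : K) * t * x ^ (n - l) + u := by
  simp only [map_add, map_smul, hasseDeriv_X_pow, eval_add, eval_smul, eval_mul, eval_C, eval_pow, eval_X, smul_eq_mul,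
    Nat.choose_self, Nat.sub_self, pow_zero, mul_one, Nat.cast_one, Nat.choose_eq_zero_of_lt hjl, Nat.cast_zero, zero_mul,
    mul_zero, add_zero]
  ring

/-- evaluation of its `j`-th Hasse derivative. [folklore] -/
theorem eval_hasseDeriv_pentanom_j (s t u v x : K) :
    (hasseDeriv j (X ^ d + s • X ^ m + t • X ^ n + u • X ^ l + v • X ^ j : K[X])).eval x =
      (d.choose j : K) * x ^ (d - j) + (m.choose j : K) * s * x ^ (m - j) + (n.choose j : K) * t * x ^ (n - j) +
        (l.choose j : K) * u * x ^ (l - j) + v := by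
  simp only [map_add, map_smul, hasseDeriv_X_pow, eval_add, eval_smul, eval_mul, eval_C, eval_pow, eval_X, smul_eq_mul,
    Nat.choose_self, Nat.sub_self, pow_zero, mul_one, Nat.cast_one]
  ring

/-- **four-witness criterion**: a centred pentanomial with roots killing `H_m`, `H_n`, `H_l`, `H_j` is Casas-Alvero. [folklore] -/
theorem isCasasAlvero_pentanom (hj0 : 0 < j) (hjl : j < l) (hln : l < n) (hnm : n < m) (hmd : m < d) {s t u v ρ σ τ υ : K}
    (hρf : (X ^ d + s • X ^ m + t • X ^ n + u • X ^ l + v • X ^ j : K[X]).eval ρ = 0)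
    (hρH : (hasseDeriv m (X ^ d + s • X ^ m + t • X ^ n + u • X ^ l + v • X ^ j : K[X])).eval ρ = 0)
    (hσf : (X ^ d + s • X ^ m + t • X ^ n + u • X ^ l + v • X ^ j : K[X]).eval σ = 0)
    (hσH : (hasseDeriv n (X ^ d + s • X ^ m + t • X ^ n + u • X ^ l + v • X ^ j : K[X])).eval σ = 0)
    (hτf : (X ^ d + s • X ^ m + t • X ^ n + u • X ^ l + v • X ^ j : K[X]).eval τ = 0)
    (hτH : (hasseDeriv l (X ^ d + s • X ^ m + t • X ^ n + u • X ^ l + v • X ^ j : K[X])).eval τ = 0)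
    (hυf : (X ^ d + s • X ^ m + t • X ^ n + u • X ^ l + v • X ^ j : K[X]).eval υ = 0)
    (hυH : (hasseDeriv j (X ^ d + s • X ^ m + t • X ^ n + u • X ^ l + v • X ^ j : K[X])).eval υ = 0) :
    IsCasasAlvero (X ^ d + s • X ^ m + t • X ^ n + u • X ^ l + v • X ^ j : K[X]) := by
  intro i hi0 hi
  rw [natDegree_pentanom hjl hln hnm hmd] at hi
  by_cases him : i = m
  · subst him; exact ⟨ρ, hρf, hρH⟩
  by_cases hin : i = n
  · subst hin; exact ⟨σ, hσf, hσH⟩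
  by_cases hil : i = l
  · subst hil; exact ⟨τ, hτf, hτH⟩
  by_cases hij : i = j
  · subst hij; exact ⟨υ, hυf, hυH⟩
  apply sharesRoot_of_coeff_eq_zero
  · rw [eval_pentanom, zero_pow (by omega), zero_pow (by omega), zero_pow (by omega), zero_pow (by omega),
      zero_pow (by omega)]; ring
  · rw [coeff_pentanom, if_neg (by omega), if_neg him, if_neg hin, if_neg hil, if_neg hij]; ring

/-- a centred pentanomial with `v ≠ 0` is not a pure `d`-th power. [folklore] -/
theorem pentanom_ne_pow (hj0 : 0 < j) (hjl : j < l) (hln : l < n) (hnm : n < m) (hmd : m < d) {s t u v : K} (hv : v ≠ 0)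
    (a : K) : (X ^ d + s • X ^ m + t • X ^ n + u • X ^ l + v • X ^ j : K[X]) ≠ (X - C a) ^ d := by
  intro h
  have h0 := congrArg (eval 0) h
  rw [eval_pentanom, zero_pow (by omega), zero_pow (by omega), zero_pow (by omega), zero_pow (by omega),
    zero_pow (by omega)] at h0
  simp only [mul_zero, add_zero, eval_pow, eval_sub, eval_X, eval_C, zero_sub] at h0
  have ha : a = 0 := neg_eq_zero.mp ((pow_eq_zero_iff (by omega : d ≠ 0)).mp h0.symm)
  subst ha
  have hc := congrArg (fun q : K[X] => q.coeff j) h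
  simp only [coeff_pentanom, map_zero, sub_zero, coeff_X_pow, if_neg (by omega : ¬ j = d),
    if_neg (by omega : ¬ j = m), if_neg (by omega : ¬ j = n), if_neg (ne_of_lt hjl), zero_add] at hc
  exact hv hc

/-- **pentanomial refutation of `CA_d`**: eight identities in `K` and `v ≠ 0`. [folklore] -/
theorem not_holdsInDegree_of_pentanomial (hj0 : 0 < j) (hjl : j < l) (hln : l < n) (hnm : n < m) (hmd : m < d)
    {s t u v : K} (hv : v ≠ 0) (ρ σ τ υ : K)
    (h1 : ρ ^ d + s * ρ ^ m + t * ρ ^ n + u * ρ ^ l + v * ρ ^ j = 0) (h2 : (d.choose m : K) * ρ ^ (d - m) + s = 0)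
    (h3 : σ ^ d + s * σ ^ m + t * σ ^ n + u * σ ^ l + v * σ ^ j = 0)
    (h4 : (d.choose n : K) * σ ^ (d - n) + (m.choose n : K) * s * σ ^ (m - n) + t = 0)
    (h5 : τ ^ d + s * τ ^ m + t * τ ^ n + u * τ ^ l + v * τ ^ j = 0)
    (h6 : (d.choose l : K) * τ ^ (d - l) + (m.choose l : K) * s * τ ^ (m - l) + (n.choose l : K) * t * τ ^ (n - l) + u = 0)
    (h7 : υ ^ d + s * υ ^ m + t * υ ^ n + u * υ ^ l + v * υ ^ j = 0)
    (h8 : (d.choose j : K) * υ ^ (d - j) + (m.choose j : K) * s * υ ^ (m - j) + (n.choose j : K) * t * υ ^ (n - j) +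
      (l.choose j : K) * u * υ ^ (l - j) + v = 0) :
    ¬ HoldsInDegree K d := by
  intro h
  have hCA : IsCasasAlvero (X ^ d + s • X ^ m + t • X ^ n + u • X ^ l + v • X ^ j : K[X]) :=
    isCasasAlvero_pentanom hj0 hjl hln hnm hmd (by rw [eval_pentanom]; exact h1)
      (by rw [eval_hasseDeriv_pentanom_m hjl hln hnm]; exact h2) (by rw [eval_pentanom]; exact h3)
      (by rw [eval_hasseDeriv_pentanom_n hjl hln]; exact h4) (by rw [eval_pentanom]; exact h5)
      (by rw [eval_hasseDeriv_pentanom_l hjl]; exact h6) (by rw [eval_pentanom]; exact h7)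
      (by rw [eval_hasseDeriv_pentanom_j]; exact h8)
  obtain ⟨a, ha⟩ := h _ (monic_pentanom hjl hln hnm hmd s t u v) (natDegree_pentanom hjl hln hnm hmd s t u v) hCA
  exact pentanom_ne_pow hj0 hjl hln hnm hmd hv a ha

end Pentanomial

/-! ### The instance: `73` is a bad prime for degree `7` -/

section Char73

variable (K : Type*) [Field K]

/-- `X^7 - 35X^4 + 32X^3 + 35X^2 - 33X` refutes `CA_7` in characteristic `73` (`H_4`-witness `1`, `H_3`-witness `1`,
`H_2`-witness `72`, `H_1`-witness `1`). Found by the witness-first linear search `ws/wsearch.py`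
(seat-2 g5 packet) after the exhaustive sparse search (kit job j072074) showed that no trinomial/tetranomial exists; re-checked by the
independent `cls/check2.py`. [folklore] -/
theorem not_holdsInDegree_seven_of_char_73 [CharP K 73] : ¬ HoldsInDegree K 7 := by
  have hp : (73 : K) = 0 := by simpa using CharP.cast_eq_zero K 73
  refine not_holdsInDegree_of_pentanomial (d := 7) (m := 4) (n := 3) (l := 2) (j := 1) (by norm_num) (by norm_num)
    (by norm_num) (by norm_num) (by norm_num) (s := -35) (t := 32) (u := 35) (v := -33) ?_ 1 1 72 1
    ?_ ?_ ?_ ?_ ?_ ?_ ?_ ?_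
  · intro h
    have h' : ((33 : ℕ) : K) = 0 := by exact_mod_cast (neg_eq_zero.mp h)
    rw [CharP.cast_eq_zero_iff K 73] at h'
    norm_num at h'
  · linear_combination (0 : K) * hp
  · simp only [show Nat.choose 7 4 = 35 from rfl]
    push_cast
    linear_combination (0 : K) * hp
  · linear_combination (0 : K) * hp
  · simp only [show Nat.choose 7 3 = 35 from rfl, show Nat.choose 4 3 = 4 from rfl]
    push_cast
    linear_combination (-1 : K) * hp
  · linear_combination (137392938936 : K) * hp
  · simp only [show Nat.choose 7 2 = 21 from rfl, show Nat.choose 4 2 = 6 from rfl, show Nat.choose 3 2 = 3 from rfl]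
    push_cast
    linear_combination (556605323 : K) * hp
  · linear_combination (0 : K) * hp
  · simp only [show Nat.choose 7 1 = 7 from rfl, show Nat.choose 4 1 = 4 from rfl, show Nat.choose 3 1 = 3 from rfl, show Nat.choose 2 1 = 2 from rfl]
    push_cast
    linear_combination (0 : K) * hp

end Char73

end Literature.Algebra.Polynomial.CasasAlvero
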